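import Literature.Probability.LatticeModels.BesselIDebyeAsymptotics
import Mathlib.Probability.Moments.Variance
import Mathlib.MeasureTheory.Function.LpSeminorm.Prod
import Mathlib.MeasureTheory.Integral.Prod
import Mathlib.Analysis.SpecialFunctions.Complex.Circle
import HarnessLib

/-!
# The dephasing bound for characteristic functions: `|𝔼 e^{iX}| ≤ exp(−½ Var X + 𝔼(X−X′)⁴/48)`

For a real random variable `X` with a fourth moment on a probability space, and an independent copy
`X′` (realised on the product space),

  `|𝔼 e^{iX}|² = 𝔼 cos(X − X′) ≤ 1 − ½ 𝔼(X−X′)² + (1/24) 𝔼(X−X′)⁴ = 1 − Var X + (1/24) 𝔼(X−X′)⁴`,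

whence `|𝔼 e^{iX}| ≤ exp(−½ Var X + 𝔼(X−X′)⁴/48)` (`norm_integral_cexp_mul_I_le_exp`). This is the
quantitative form of the *second-order structural sign of a purely imaginary perturbation*: for a
real functional `V` and `ε → 0`,
`|𝔼 e^{−iεV}| ≤ exp(−½ ε² Var V + O(ε⁴))`, i.e. `−log|𝔼 e^{−iεV}| = +½ ε² Var V + O(ε⁴) ≥ 0`
— integrating out fluctuations against an oscillating weight can only *decrease* the modulus at
second order ("order by dephasing"; in a renormalisation-group step with a reflection-odd
imaginary vertex `iV`, the effective action gains the real, non-negative term `½ Var(V)`).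

Ingredients: the even Taylor polynomial of degree 4 dominates the cosine,
`cos t ≤ 1 − t²/2 + t⁴/24` for all real `t` (the tree's
`Literature.Probability.LatticeModels.cos_le_one_sub_sq_half_add_fourth`), the identity
`|𝔼 e^{iX}|² = 𝔼_{μ⊗μ} cos(X(ω) − X(ω′))` (`sq_norm_integral_cexp_mul_I`), and
`𝔼_{μ⊗μ}(X(ω) − X(ω′))² = 2 Var X` (`integral_sub_sq_prod_eq_two_mul_variance`).

## References

* W. Feller, *An Introduction to Probability Theory and its Applications*, Vol. II, 2nd ed.,
  Wiley 1971, XV.4 (characteristic functions, symmetrisation `|φ|²`, moment expansions). [Feller1971]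
-/

noncomputable section

namespace Literature.Probability.Distributions

open MeasureTheory ProbabilityTheory Set Filter

/-! ### Symmetrisation: `|𝔼 e^{iX}|² = 𝔼 cos(X − X′)` -/

variable {Ω : Type*} [MeasurableSpace Ω] {μ : Measure Ω} [IsProbabilityMeasure μ] {X : Ω → ℝ}

/-- A bounded measurable real function of `X` is integrable on a probability space. [folklore] -/
theorem integrable_of_abs_le_one (hX : AEMeasurable X μ) {g : ℝ → ℝ} (hg : Continuous g)
    (hb : ∀ t, |g t| ≤ 1) : Integrable (fun ω => g (X ω)) μ := by
  refine Integrable.mono' (integrable_const (1 : ℝ)) (hg.measurable.comp_aemeasurable hX).aestronglyMeasurable ?_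
  exact ae_of_all _ fun ω => by simpa [Real.norm_eq_abs] using hb (X ω)

/-- The characteristic-function value as real and imaginary parts:
`𝔼 e^{iX} = 𝔼 cos X + i 𝔼 sin X`. [folklore] -/
theorem integral_cexp_mul_I_eq (hX : AEMeasurable X μ) :
    ∫ ω, Complex.exp ((X ω : ℂ) * Complex.I) ∂μ =
      ((∫ ω, Real.cos (X ω) ∂μ : ℝ) : ℂ) + ((∫ ω, Real.sin (X ω) ∂μ : ℝ) : ℂ) * Complex.I := by
  have hc : Integrable (fun ω => ((Real.cos (X ω) : ℝ) : ℂ)) μ :=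
    (integrable_of_abs_le_one hX Real.continuous_cos Real.abs_cos_le_one).ofReal
  have hs : Integrable (fun ω => ((Real.sin (X ω) : ℝ) : ℂ) * Complex.I) μ :=
    ((integrable_of_abs_le_one hX Real.continuous_sin Real.abs_sin_le_one).ofReal).mul_const _
  have hfun : ∀ ω, Complex.exp ((X ω : ℂ) * Complex.I) =
      ((Real.cos (X ω) : ℝ) : ℂ) + ((Real.sin (X ω) : ℝ) : ℂ) * Complex.I := fun ω => by
    rw [Complex.exp_mul_I, Complex.ofReal_cos, Complex.ofReal_sin]
  simp_rw [hfun]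
  rw [integral_add hc hs, integral_mul_const, integral_complex_ofReal, integral_complex_ofReal]

/-- **Symmetrisation identity**: `|𝔼 e^{iX}|² = 𝔼_{μ⊗μ} cos(X(ω) − X(ω′))`. [cite: Feller1971, XV.4] -/
theorem sq_norm_integral_cexp_mul_I (hX : AEMeasurable X μ) :
    ‖∫ ω, Complex.exp ((X ω : ℂ) * Complex.I) ∂μ‖ ^ 2 =
      ∫ p, Real.cos (X p.1 - X p.2) ∂(μ.prod μ) := by
  rw [integral_cexp_mul_I_eq hX, Complex.sq_norm, Complex.normSq_apply]
  simp only [Complex.add_re, Complex.ofReal_re, Complex.mul_re, Complex.I_re, mul_zero, Complex.ofReal_im,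
    Complex.I_im, mul_one, sub_self, add_zero, Complex.add_im, Complex.mul_im, zero_add]
  simp_rw [Real.cos_sub]
  have h1 : Integrable (fun p : Ω × Ω => Real.cos (X p.1) * Real.cos (X p.2)) (μ.prod μ) := by
    refine Integrable.mono' (integrable_const (1 : ℝ)) ?_ (ae_of_all _ fun p => ?_)
    · exact ((Real.continuous_cos.measurable.comp_aemeasurable hX).aestronglyMeasurable.comp_fst.mul
        (Real.continuous_cos.measurable.comp_aemeasurable hX).aestronglyMeasurable.comp_snd)
    · rw [norm_mul, Real.norm_eq_abs, Real.norm_eq_abs]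
      exact mul_le_one₀ (Real.abs_cos_le_one _) (abs_nonneg _) (Real.abs_cos_le_one _)
  have h2 : Integrable (fun p : Ω × Ω => Real.sin (X p.1) * Real.sin (X p.2)) (μ.prod μ) := by
    refine Integrable.mono' (integrable_const (1 : ℝ)) ?_ (ae_of_all _ fun p => ?_)
    · exact ((Real.continuous_sin.measurable.comp_aemeasurable hX).aestronglyMeasurable.comp_fst.mul
        (Real.continuous_sin.measurable.comp_aemeasurable hX).aestronglyMeasurable.comp_snd)
    · rw [norm_mul, Real.norm_eq_abs, Real.norm_eq_abs]
      exact mul_le_one₀ (Real.abs_sin_le_one _) (abs_nonneg _) (Real.abs_sin_le_one _)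
  have hp1 := integral_prod_mul (μ := μ) (ν := μ) (fun ω => Real.cos (X ω)) (fun ω => Real.cos (X ω))
  have hp2 := integral_prod_mul (μ := μ) (ν := μ) (fun ω => Real.sin (X ω)) (fun ω => Real.sin (X ω))
  rw [integral_add h1 h2, hp1, hp2]

/-! ### Second moment of the symmetrised variable -/

/-- `𝔼_{μ⊗μ} (X(ω) − X(ω′))² = 2 Var X`. [cite: Feller1971, XV.4] -/
theorem integral_sub_sq_prod_eq_two_mul_variance (hX : MemLp X 2 μ) :
    ∫ p, (X p.1 - X p.2) ^ 2 ∂(μ.prod μ) = 2 * variance X μ := by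
  have hXi : Integrable X μ := hX.integrable one_le_two
  have hX2 : Integrable (fun ω => X ω ^ 2) μ := hX.integrable_sq
  have hf1 : Integrable (fun p : Ω × Ω => X p.1 ^ 2) (μ.prod μ) := (hX.comp_fst μ).integrable_sq
  have hf2 : Integrable (fun p : Ω × Ω => X p.2 ^ 2) (μ.prod μ) := (hX.comp_snd μ).integrable_sq
  have hf12 : Integrable (fun p : Ω × Ω => X p.1 * X p.2) (μ.prod μ) := hXi.mul_prod hXi
  have hexp : ∀ p : Ω × Ω, (X p.1 - X p.2) ^ 2 = X p.1 ^ 2 + X p.2 ^ 2 - 2 * (X p.1 * X p.2) := fun p => by ring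
  simp_rw [hexp]
  have hsum : Integrable (fun p : Ω × Ω => X p.1 ^ 2 + X p.2 ^ 2) (μ.prod μ) := hf1.add hf2
  have h2m : Integrable (fun p : Ω × Ω => 2 * (X p.1 * X p.2)) (μ.prod μ) := hf12.const_mul 2
  have hp := integral_prod_mul (μ := μ) (ν := μ) X X
  rw [integral_sub hsum h2m, integral_add hf1 hf2, integral_const_mul, hp,
    integral_fun_fst (fun ω => X ω ^ 2), integral_fun_snd (fun ω => X ω ^ 2), variance_eq_sub hX]
  simp only [probReal_univ, one_smul]
  have hsq : μ[X ^ 2] = ∫ ω, X ω ^ 2 ∂μ := by rfl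
  rw [hsq]
  ring

/-! ### The dephasing bound -/

/-- **The dephasing bound, squared form**: `|𝔼 e^{iX}|² ≤ 1 − Var X + (1/24) 𝔼_{μ⊗μ}(X−X′)⁴`.
[cite: Feller1971, XV.4] -/
theorem sq_norm_integral_cexp_mul_I_le (hX : MemLp X 4 μ) :
    ‖∫ ω, Complex.exp ((X ω : ℂ) * Complex.I) ∂μ‖ ^ 2 ≤
      1 - variance X μ + (∫ p, (X p.1 - X p.2) ^ 4 ∂(μ.prod μ)) / 24 := by
  have hX2 : MemLp X 2 μ := hX.mono_exponent (by norm_num)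
  have hZ : MemLp (fun p : Ω × Ω => X p.1 - X p.2) 4 (μ.prod μ) := (hX.comp_fst μ).sub (hX.comp_snd μ)
  have hZ4 : Integrable (fun p : Ω × Ω => (X p.1 - X p.2) ^ 4) (μ.prod μ) := by
    have h := hZ.integrable_norm_pow (by norm_num)
    refine h.congr (ae_of_all _ fun p => ?_)
    simp only [Real.norm_eq_abs]
    rw [show (4 : ℕ) = 2 * 2 from rfl, pow_mul, pow_mul, sq_abs]
  have hZ2 : Integrable (fun p : Ω × Ω => (X p.1 - X p.2) ^ 2) (μ.prod μ) :=
    (hZ.mono_exponent (by norm_num)).integrable_sq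
  have hcos : Integrable (fun p : Ω × Ω => Real.cos (X p.1 - X p.2)) (μ.prod μ) := by
    refine Integrable.mono' (integrable_const (1 : ℝ)) ?_ (ae_of_all _ fun p => ?_)
    · exact (Real.continuous_cos.comp_aestronglyMeasurable hZ.1)
    · simpa [Real.norm_eq_abs] using Real.abs_cos_le_one (X p.1 - X p.2)
  rw [sq_norm_integral_cexp_mul_I hX.aestronglyMeasurable.aemeasurable]
  calc ∫ p, Real.cos (X p.1 - X p.2) ∂(μ.prod μ)
      ≤ ∫ p, (1 - (X p.1 - X p.2) ^ 2 / 2 + (X p.1 - X p.2) ^ 4 / 24) ∂(μ.prod μ) :=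
        integral_mono hcos (show Integrable (fun p : Ω × Ω => 1 - (X p.1 - X p.2) ^ 2 / 2 + (X p.1 - X p.2) ^ 4 / 24)
            (μ.prod μ) from ((integrable_const (1 : ℝ)).sub (hZ2.div_const 2)).add (hZ4.div_const 24))
          fun p => Literature.Probability.LatticeModels.cos_le_one_sub_sq_half_add_fourth _
    _ = 1 - variance X μ + (∫ p, (X p.1 - X p.2) ^ 4 ∂(μ.prod μ)) / 24 := by
        have hA : Integrable (fun p : Ω × Ω => (1 : ℝ) - (X p.1 - X p.2) ^ 2 / 2) (μ.prod μ) :=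
          (integrable_const (1 : ℝ)).sub (hZ2.div_const 2)
        have hB : Integrable (fun p : Ω × Ω => (X p.1 - X p.2) ^ 4 / 24) (μ.prod μ) := hZ4.div_const 24
        have hC : Integrable (fun p : Ω × Ω => (X p.1 - X p.2) ^ 2 / 2) (μ.prod μ) := hZ2.div_const 2
        rw [integral_add hA hB, integral_sub (integrable_const (1 : ℝ)) hC, integral_div, integral_div,
          integral_sub_sq_prod_eq_two_mul_variance hX2, integral_const]
        simp only [probReal_univ, one_smul]
        ring

/-- **The dephasing bound**: for a real random variable with a fourth moment on a probability space,
`|𝔼 e^{iX}| ≤ exp(−½ Var X + 𝔼_{μ⊗μ}(X−X′)⁴/48)`. Applied to `εV` this is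
`|𝔼 e^{iεV}| ≤ exp(−½ε² Var V + ε⁴ 𝔼(V−V′)⁴/48)`: the modulus decreases at second order, with the
structural sign `+½ Var V ≥ 0`. [cite: Feller1971, XV.4] -/
theorem norm_integral_cexp_mul_I_le_exp (hX : MemLp X 4 μ) :
    ‖∫ ω, Complex.exp ((X ω : ℂ) * Complex.I) ∂μ‖ ≤
      Real.exp (-(variance X μ) / 2 + (∫ p, (X p.1 - X p.2) ^ 4 ∂(μ.prod μ)) / 48) := by
  set z : ℝ := -variance X μ + (∫ p, (X p.1 - X p.2) ^ 4 ∂(μ.prod μ)) / 24 with hz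
  have hsq : ‖∫ ω, Complex.exp ((X ω : ℂ) * Complex.I) ∂μ‖ ^ 2 ≤ 1 + z := by
    have h := sq_norm_integral_cexp_mul_I_le hX
    rw [hz]; linarith
  have hexp : 1 + z ≤ Real.exp z := by linarith [Real.add_one_le_exp z]
  have hkey : ‖∫ ω, Complex.exp ((X ω : ℂ) * Complex.I) ∂μ‖ ^ 2 ≤ (Real.exp (z / 2)) ^ 2 := by
    rw [← Real.exp_nat_mul]
    push_cast
    rw [show (2 : ℝ) * (z / 2) = z by ring]
    exact hsq.trans hexp
  have hle : ‖∫ ω, Complex.exp ((X ω : ℂ) * Complex.I) ∂μ‖ ≤ Real.exp (z / 2) :=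
    (pow_le_pow_iff_left₀ (norm_nonneg _) (Real.exp_pos _).le two_ne_zero).1 hkey
  have hz2 : z / 2 = -(variance X μ) / 2 + (∫ p, (X p.1 - X p.2) ^ 4 ∂(μ.prod μ)) / 48 := by
    rw [hz]; ring
  rwa [hz2] at hle

end Literature.Probability.Distributions

end
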